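import Summits.ResolutionOfSingularities.ResolutionOfSingularities.Theorems.HilbertSamuelEliminationSigmaMaxModificationsCorridor3WLadderStrataClean
import Summits.ResolutionOfSingularities.ResolutionOfSingularities.Theorems.HilbertSamuelEliminationSigmaMaxModificationsCorridor3WLadderStrataCurveDictionary
import Summits.ResolutionOfSingularities.ResolutionOfSingularities.Theorems.HilbertSamuelEliminationSigmaMaxModificationsCorridor3WLadderRecognitionIso
import Literature.AlgebraicGeometry.Resolution.RegularLocalRingsNormal
import HarnessLib

/-!
# [OURS · L1 W4.2] ROW (K-ctr), CURVE-CENTRE CASE, part B (algebra by transport): the member of `X_{n+1}(ν)` through `x_{n+1}`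
# DOMINATING the blown-up regular curve `D` is a REGULAR CURVE at `x_{n+1}` — it is ISOMORPHIC to `D` (crux chain w42, STUB TABLE
# «(K-ctr) 038@e=2 + curve-centre dominant via Thm 3.6 / 3.14-at-η», hand res-D-pv-038)

OURS (cell `res-hironaka`, slot W4.2, crux `stmt-ResolutionOfSingularities-18506` / conjunct `-19249`; `--supports … --as helper`,
counted 0).  NOT a statement of the manuscript under review [claim: Hironaka2017, status: under-review] nor of [CossartJannsenSaito2020];
AI plumbing, weaker than expert review; every `theorem` is PROVED, no definition is introduced.

## What (clause 2 of stub-4's row `Moving.StrataCentreMembersClean`, p516588, at a CURVE-centre step)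

`π : X′ ⟶ X` proper (a blow-up), `D ⊆ X` closed irreducible, the centre, a curve REGULAR in the sense that its reduced closed subscheme is
regular (a permissible centre, `CampaignW42.isRegular_subscheme_of_isPermissible`) and a curve at the closed chain point `x = π(x′)`
(stub-4's clause: irreducible closed subsets of `D` through `x` are `{x}` or `D`), `W = X′(ν)` closed.  BINDERS BY NAME (CJS Thm. 3.14 in
relative form): `hfib : ∀ y ∈ D, (W ∩ π⁻¹{y}).Subsingleton` (over EVERY point of the centre curve at most one point of the stratum: at the
closed points the T7b general-centre clause of res-type-001, at the generic point the η-door F-C of res-L1-s42-pv-1 fed by F-65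
`CossartJannsenSaito2020_thm_3_6`) and `hres` (at the generic point `ζ′` of the member, `κ(η) → κ(ζ′)` is an isomorphism — the
rationality clause of the η-door).  Then for a member `Z′ ≠ {x′}` of `componentsThrough N ν s` mapping into `D`:
* `bijOn_centre_of_dominant` — `π` restricts to a BIJECTION `Z′ → D` (injective by `hfib`, onto since `π(Z′)` is closed and dominates `D`,
  part A's topology redone inline);
* `inducesIsoOn_centre_of_dominant` — hence, `D_red` being regular hence NORMAL (Matsumura 19.4, tree `isIntegrallyClosed_of_isRegularLocalRing`),
  `π` induces an ISOMORPHISM `Z′_red ⥲ D_red` (res-L1-w42-stub-2's `Helpers.inducesIsoOn_of_bijOn_of_isIso_residueFieldMap_generic`, p516852 +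
  rev: Zariski's Main Theorem + finite birational onto normal);
* `isRegularCurveAt_of_dominant_over_centre` — transporting along the isomorphism: `𝒪_{X′,x′}/I(Z′)_{x′} ≅ 𝒪_{Z′_red,x′} ≅ 𝒪_{D_red,x} ≅
  𝒪_{X,x}/I(D)_x` is regular of dimension `≤ 1` (stub-4's dictionary `ringKrullDim_quotient_le_one_of_curve` /
  `curve_of_ringKrullDim_quotient_le_one`, `nonempty_stalkSubschemeEquiv'`), i.e. `Moving.IsRegularCurveAt s Z′`;
* `strataCentreMembersClean_curveCase_regular` — clause 2 of (K-ctr) at a curve-centre step (the member `{x′}` is a regular curve at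
  `x′` trivially).

[cite: CossartJannsenSaito2020, Thm. 3.14, Thm. 3.6, Def. 6.34 (iii), Rem. 6.29 (1)]
-/

noncomputable section

set_option linter.dupNamespace false -- mandated namespace `…ResolutionOfSingularities.ResolutionOfSingularities…` of this single-conjunct summit

open CategoryTheory AlgebraicGeometry TopologicalSpace Topology IsLocalRing
open Summit.ResolutionOfSingularities.ResolutionOfSingularities.Theorems.CampaignW42
open Literature.AlgebraicGeometry.Resolution
open Literature.AlgebraicGeometry.CossartJannsenSaito2020
open Summit.ResolutionOfSingularities.ResolutionOfSingularities.Theorems.SigmaMaxModificationsCorridor3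
open Summit.ResolutionOfSingularities.ResolutionOfSingularities.Theorems.SigmaMaxModificationsCorridor3.Helpers

universe u

namespace Summit.ResolutionOfSingularities.ResolutionOfSingularities.Theorems.SigmaMaxModificationsCorridor3.Moving

variable {N : ℕ} {ν : ℕ → ℕ}

/-! ## §1. The dominant member maps bijectively onto the centre curve -/

/-- **`π : Z′ → D` is a bijection** for an irreducible closed `Z′ ⊆ W` through `x′` over `x ∈ D`, `Z′ ≠ {x′}`, mapping into the curve
`D` (curve at `x`), when over every point of `D` at most one point of `W` lies and `π` is a closed map.
[cite: CossartJannsenSaito2020, Thm. 3.14, Rem. 6.29 (1)] -/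
theorem bijOn_centre_of_dominant {X X' : Scheme.{u}} (π : X' ⟶ X) (hπc : IsClosedMap π.base) {D : Set X}
    (hDc : IsClosed D) {x : X} (hcurve : ∀ A : Set X, IsIrreducible A → IsClosed A → x ∈ A → A ⊆ D → A = {x} ∨ A = D)
    {W : Set X'} (hfib : ∀ y ∈ D, (W ∩ π.base ⁻¹' {y}).Subsingleton)
    {Z' : Set X'} (hZ'W : Z' ⊆ W) (hZ'irr : IsIrreducible Z') (hZ'c : IsClosed Z') {x' : X'} (hx'Z : x' ∈ Z')
    (hπx' : π.base x' = x) (hZ'D : π.base '' Z' ⊆ D) (hne : Z' ≠ {x'}) : Set.BijOn π.base Z' D := by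
  have hxD : x ∈ D := hZ'D ⟨x', hx'Z, hπx'⟩
  -- not in the fibre over `x`
  have hnot : ¬ Z' ⊆ π.base ⁻¹' {x} := fun h =>
    hne (Set.eq_singleton_iff_unique_mem.2 ⟨hx'Z, fun z hz =>
      hfib x hxD ⟨hZ'W hz, h hz⟩ ⟨hZ'W hx'Z, by simpa using hπx'⟩⟩)
  -- dominance from the curve clause
  have hirr : IsIrreducible (closure (π.base '' Z')) := (hZ'irr.image _ π.continuous.continuousOn).closure
  have hxcl : x ∈ closure (π.base '' Z') := subset_closure ⟨x', hx'Z, hπx'⟩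
  have hdom : closure (π.base '' Z') = D := by
    rcases hcurve _ hirr isClosed_closure hxcl (closure_minimal hZ'D hDc) with h | h
    · exact absurd (fun z hz => by
        have hz' : π.base z ∈ closure (π.base '' Z') := subset_closure ⟨z, hz, rfl⟩
        rw [h] at hz'
        exact hz') hnot
    · exact h
  have himg : π.base '' Z' = D := by rw [← (hπc _ hZ'c).closure_eq, hdom]
  refine ⟨fun z hz => hZ'D ⟨z, hz, rfl⟩, fun z₁ h₁ z₂ h₂ h => ?_, fun y hy => by rw [← himg] at hy; exact hy⟩
  exact hfib (π.base z₁) (hZ'D ⟨z₁, h₁, rfl⟩) ⟨hZ'W h₁, rfl⟩ ⟨hZ'W h₂, h.symm⟩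

/-! ## §2. The dominant member is isomorphic to the centre curve -/

/-- **`π` induces an isomorphism `Z′_red ⥲ D_red`** when, moreover, `D_red` is a regular scheme and the residue extension at the generic
point of `Z′` is trivial (finite birational onto normal, res-L1-w42-stub-2's (R3′) lemma). [cite: CossartJannsenSaito2020, Def. 6.34 (iii), Thm. 3.14] -/
theorem inducesIsoOn_centre_of_dominant {X X' : Scheme.{u}} (π : X' ⟶ X) [IsProper π] {D : Set X} (hDc : IsClosed D)
    (hDirr : IsIrreducible D) (hDreg : Scheme.IsRegular (Scheme.IdealSheafData.vanishingIdeal ⟨D, hDc⟩).subscheme) {x : X}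
    (hcurve : ∀ A : Set X, IsIrreducible A → IsClosed A → x ∈ A → A ⊆ D → A = {x} ∨ A = D)
    {W : Set X'} (hfib : ∀ y ∈ D, (W ∩ π.base ⁻¹' {y}).Subsingleton)
    {Z' : Set X'} (hZ'W : Z' ⊆ W) (hZ'irr : IsIrreducible Z') (hZ'c : IsClosed Z') {x' : X'} (hx'Z : x' ∈ Z')
    (hπx' : π.base x' = x) (hZ'D : π.base '' Z' ⊆ D) (hne : Z' ≠ {x'})
    (hres : ∀ y' ∈ Z', IsGenericPoint y' Z' → IsIso (π.residueFieldMap y')) :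
    InducesIsoOn π Z' hZ'c D hDc :=
  inducesIsoOn_of_bijOn_of_isIso_residueFieldMap_generic π hZ'c hDc hZ'irr hDirr
    (bijOn_centre_of_dominant π π.isClosedMap hDc hcurve hfib hZ'W hZ'irr hZ'c hx'Z hπx' hZ'D hne) hres
    fun z => by haveI := hDreg z; exact isIntegrallyClosed_of_isRegularLocalRing _

/-! ## §3. Transport: the dominant member is a regular curve at the marked point -/

/-- **The member of `componentsThrough N ν s` DOMINATING the blown-up regular curve `D` is a regular curve at the marked point**
(`Moving.IsRegularCurveAt s Z′`): its reduced local ring at `x′` is isomorphic to that of `D` at `x`, regular of dimension `≤ 1`.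
Binders BY NAME: `hfib` (CJS Thm. 3.14, relative form, at every point of `D`) and `hres` (trivial residue extension at the generic point).
[cite: CossartJannsenSaito2020, Thm. 3.14, Thm. 3.6, Def. 6.34 (iii), Rem. 6.29 (1)] -/
theorem isRegularCurveAt_of_dominant_over_centre {X : Scheme.{u}} (s : MarkedStage.{u}) (π : s.W ⟶ X) [IsProper π]
    {D : Set X} (hDc : IsClosed D) (hDirr : IsIrreducible D)
    (hDreg : Scheme.IsRegular (Scheme.IdealSheafData.vanishingIdeal ⟨D, hDc⟩).subscheme) {x : X} (hπx : π.base s.pt = x)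
    (hcurve : ∀ A : Set X, IsIrreducible A → IsClosed A → x ∈ A → A ⊆ D → A = {x} ∨ A = D)
    (hptc : IsClosed ({s.pt} : Set s.W)) (hWc : IsClosed (Scheme.hsStratum s.W N ν))
    (hfib : ∀ y ∈ D, (Scheme.hsStratum s.W N ν ∩ π.base ⁻¹' {y}).Subsingleton)
    {Z' : Set s.W} (hZ' : Z' ∈ componentsThrough N ν s) (hZ'D : π.base '' Z' ⊆ D) (hne : Z' ≠ {s.pt})
    (hres : ∀ y' ∈ Z', IsGenericPoint y' Z' → IsIso (π.residueFieldMap y')) : IsRegularCurveAt s Z' := by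
  haveI : IsLocallyNoetherian s.W := s.ln
  have hZ'c : IsClosed Z' := componentsIn.isClosed hWc hZ'.1
  have hZ'irr : IsIrreducible Z' := componentsIn.isIrreducible hZ'.1
  -- notation for the two reduced subschemes
  set I' : s.W.IdealSheafData := Scheme.IdealSheafData.vanishingIdeal ⟨Z', hZ'c⟩ with hI'
  set I : X.IdealSheafData := Scheme.IdealSheafData.vanishingIdeal ⟨D, hDc⟩ with hI
  obtain ⟨e, he⟩ : ∃ e : I'.subscheme ≅ I.subscheme, e.hom ≫ I.subschemeι = I'.subschemeι ≫ π :=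
    inducesIsoOn_centre_of_dominant π hDc hDirr hDreg hcurve hfib (componentsIn.subset hZ'.1) hZ'irr hZ'c
      hZ'.2 hπx hZ'D hne hres
  -- the point `c′` of `Z′_red` under `x′`
  have hsupp' : (I'.support : Set s.W) = Z' := by rw [hI', Scheme.IdealSheafData.coe_support_vanishingIdeal]; rfl
  have hrange' : Set.range I'.subschemeι.base = Z' := by
    have h := I'.range_subschemeι
    rw [hsupp'] at h
    exact h
  obtain ⟨c', hc'⟩ : ∃ c', I'.subschemeι.base c' = s.pt := by rw [← Set.mem_range, hrange']; exact hZ'.2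
  -- the point `e c′` of `D_red` lies over `x`
  have hc : I.subschemeι.base (e.hom.base c') = x := by
    have h1 := congrArg (fun f => f.base c') he
    simp only [Scheme.Hom.comp_base, TopCat.coe_comp, Function.comp_apply] at h1
    rw [h1, hc', hπx]
  -- the three ring isomorphisms
  obtain ⟨e1⟩ := nonempty_stalkSubschemeEquiv' I' c'          -- 𝒪_{X′,x′}/I′ ≃ 𝒪_{Z′_red,c′}
  have e2 : (I.subscheme.presheaf.stalk (e.hom.base c') : Type u) ≃+* I'.subscheme.presheaf.stalk c' :=
    (asIso (e.hom.stalkMap c')).commRingCatIsoToRingEquiv   -- 𝒪_{D_red,e c′} ≃ 𝒪_{Z′_red,c′}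
  obtain ⟨e3⟩ := nonempty_stalkSubschemeEquiv' I (e.hom.base c')  -- 𝒪_{X,x}/I ≃ 𝒪_{D_red,e c′}
  -- regularity and dimension downstairs
  haveI hregc : IsRegularLocalRing (I.subscheme.presheaf.stalk (e.hom.base c')) := hDreg _
  have hdimx : ringKrullDim (X.presheaf.stalk (I.subschemeι.base (e.hom.base c')) ⧸
      stalkIdeal I (I.subschemeι.base (e.hom.base c'))) ≤ 1 := by
    rw [hc]
    exact ringKrullDim_quotient_le_one_of_curve hDc hcurve
  have hdimc : ringKrullDim (I.subscheme.presheaf.stalk (e.hom.base c')) ≤ 1 := by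
    rw [← ringKrullDim_eq_of_ringEquiv e3]; exact hdimx
  -- transported upstairs
  have hreg' : IsRegularLocalRing (s.W.presheaf.stalk (I'.subschemeι.base c') ⧸ stalkIdeal I' (I'.subschemeι.base c')) := by
    haveI : IsRegularLocalRing (I'.subscheme.presheaf.stalk c') := IsRegularLocalRing.of_ringEquiv e2
    exact IsRegularLocalRing.of_ringEquiv e1.symm
  have hdim' : ringKrullDim (s.W.presheaf.stalk (I'.subschemeι.base c') ⧸ stalkIdeal I' (I'.subschemeι.base c')) ≤ 1 := by
    rw [ringKrullDim_eq_of_ringEquiv e1, ← ringKrullDim_eq_of_ringEquiv e2]; exact hdimc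
  rw [hc'] at hreg' hdim'
  refine ⟨hZ'.2, fun hZc => hreg', ?_⟩
  exact curve_of_ringKrullDim_quotient_le_one hZ'irr hZ'c hptc hdim'

/-- **(K-ctr), CLAUSE 2, CURVE-CENTRE CASE**: at a step blowing up a regular curve `D` through the chain point, every member of
`componentsThrough N ν s` mapping into `D` is a regular curve at the marked point (`{x_{n+1}}` trivially; the dominant member by
`isRegularCurveAt_of_dominant_over_centre`). [cite: CossartJannsenSaito2020, Thm. 3.14, Thm. 3.6, Rem. 6.29 (1)] -/
theorem strataCentreMembersClean_curveCase_regular {X : Scheme.{u}} (s : MarkedStage.{u}) (π : s.W ⟶ X) [IsProper π]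
    {D : Set X} (hDc : IsClosed D) (hDirr : IsIrreducible D)
    (hDreg : Scheme.IsRegular (Scheme.IdealSheafData.vanishingIdeal ⟨D, hDc⟩).subscheme) {x : X} (hπx : π.base s.pt = x)
    (hcurve : ∀ A : Set X, IsIrreducible A → IsClosed A → x ∈ A → A ⊆ D → A = {x} ∨ A = D)
    (hptc : IsClosed ({s.pt} : Set s.W)) (hWc : IsClosed (Scheme.hsStratum s.W N ν))
    (hfib : ∀ y ∈ D, (Scheme.hsStratum s.W N ν ∩ π.base ⁻¹' {y}).Subsingleton)
    (hres : ∀ Z' ∈ componentsThrough N ν s, π.base '' Z' ⊆ D →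
      ∀ y' ∈ Z', IsGenericPoint y' Z' → IsIso (π.residueFieldMap y')) :
    ∀ Z' ∈ componentsThrough N ν s, π.base '' Z' ⊆ D → IsRegularCurveAt s Z' := by
  intro Z' hZ' hZ'D
  haveI : IsLocallyNoetherian s.W := s.ln
  by_cases hne : Z' = {s.pt}
  · subst hne
    refine ⟨Set.mem_singleton _, fun hZc => ?_, fun A _ _ hptA hAZ => Or.inl ?_⟩
    · rw [stalkIdeal_vanishingIdeal_singleton hZc]
      haveI : (maximalIdeal (s.W.presheaf.stalk s.pt)).IsMaximal := maximalIdeal.isMaximal _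
      letI : Field (s.W.presheaf.stalk s.pt ⧸ maximalIdeal (s.W.presheaf.stalk s.pt)) := Ideal.Quotient.field _
      infer_instance
    · exact Set.Subset.antisymm hAZ (Set.singleton_subset_iff.2 hptA)
  · exact isRegularCurveAt_of_dominant_over_centre s π hDc hDirr hDreg hπx hcurve hptc hWc hfib hZ' hZ'D hne (hres Z' hZ' hZ'D)

end Summit.ResolutionOfSingularities.ResolutionOfSingularities.Theorems.SigmaMaxModificationsCorridor3.Moving

end
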